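import Literature.NumberTheory.EllipticCurves.KuriharaNumberInvariants
import Literature.NumberTheory.EllipticCurves.LeadingTermPPartProofs
import Summits.BirchSwinnertonDyer.Rank1Residual.X4.KuriharaClasswide
import HarnessLib

/-!
# Kim 2026 Thm. 1.8 (6) — the VERBATIM CORE `length Ш[p^∞] = ∂^{(ord δ̃)}(δ̃) − ∂^{(∞)}(δ̃)` as a typed
# per-pair predicate and its analytic-rank-`0` reading (cell `b2b-bsdres`, lane CLASS-CLOSURE, seat
# cc-typer-1 = typer ask T1 of CLASS-CLOSURE-PLAN §3.1; team n1011 OWNERS rows T-a2 / T-N10C / T-N10K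
# name this file's objects as their input; sibling `Additive/X4SharpThreeKimShaLength.lean` = the p = 3 items)

HONEST FRAMING (cell `b2b-bsdres`, run/shared/lean/b2b/bsd-rank1-residual/, verbatim in every
file): the goal of the cell is to DELETE the COMBINATION-SHAPED residual classes of the
Birch–Swinnerton-Dyer formula for ALL analytic-rank `≤ 1` elliptic curves over `ℚ` — "full BSD
formula for every rank `≤ 1` curve in class `C`" assembled STRICTLY from published theorems — so
that the rank-`≤ 1` remainder becomes exactly the CONSTRUCTION-SHAPED classes, which are TYPED
(missing-input `Prop`s), NOT attempted. This is not "finishing BSD". Lane CLASS-CLOSURE (coordinator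
ruling 2026-08-21T04:07:19Z): research routes; no claim beyond stated classes; census output =
EVIDENCE / conjecture items with held-out validation, never a Literature fact; nothing below is
booked; the label X4 and the mark of RESIDUAL-MAP §I N11 are UNCHANGED by this file. NOTHING is
asserted: `@[conjecture] def … : Prop` predicates and bookkeeping theorems whose every published
input is an explicit named-fact hypothesis of the tree.

## What this file types, and how it sits next to the team's files

Typer ask T1 (CLASS-CLOSURE-PLAN §3.1, ttrl2 line): "the VERBATIM core of Kim Thm 1.8 (6) as a typed
predicate over (δ-vanishing order, `∂`-data, `ord_p Ш`, Tam, Manin, tower bit)". The `∂`-vocabulary —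
`kuriharaVanishingOrder` (`ord(δ̃)`), `kuriharaPartial` (`∂^{(i)}(δ̃)`), `kuriharaPartialInfty`
(`∂^{(∞)}(δ̃)`), over the CYCLIC Kolyvagin levels of the tree's Kurihara numbers
`kuriharaNumber f (p^k) n ψ` — is `Literature/NumberTheory/EllipticCurves/KuriharaNumberInvariants.lean`
(p249101; Kim §1.4.4, §1.5.1, §2.5.1, Def. 2.13 transcribed with the verbatim quotes). On it:

* §1 **`KimShaLengthAt W p f`** — clause (6) VERBATIM at the pair, normalisation-internal (every term
  is read off `f`'s own Kurihara numbers; `∂^{(0)} = ord_p δ_1 = ord_p [0]⁺_f`): "for every `r` with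
  `ord(δ̃) = r`: `∂^{(∞)}(δ̃)` is a natural number `d` and `∂^{(r)}(δ̃) = ord_p #Ш(E/ℚ)(p) + d`".
  **`KimShaLengthRankZeroAt W p f`** — its analytic-rank-`0` reading in BSD currency, Kim §1.5.1
  "`∂^{(0)}(δ̃)` = the `p`-adic valuation of `δ̃_1`", `δ̃_1 = L(E,1)/Ω⁺_E` (§1.4.3): "`L(E,1)/Ω(W)` is
  a rational `q`, `∂^{(∞)}(δ̃) = d ∈ ℕ`, `ord_p q = ord_p #Ш(E/ℚ)(p) + d`" — the shape of the tree's
  unit-Kurihara-number facts with the unit (`d = 0`) removed. The bridge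
  `kimShaLengthRankZeroAt_of_kimShaLengthAt` (period transfer `Ω(W) = u·Ω⁺_f`, `|u|_p = 1`; `p` odd;
  `E[p]` irreducible for the `p`-integrality of `[0]⁺_f`) proves the second from the first.
* §2 **Fact-free bookkeeping on the rank-`0` witness `(q, d)`**: `BSD(E,p) ⟺ d = ord_p ∏_ℓ c_ℓ(E)`
  (`bsdp_iff_eq_tamagawa_of_rankZero_witness` — the kernel form of "(6) + [Kim's Conjecture 1.9,
  `∂^{(∞)}(δ̃) = ∑_ℓ ord_p c_ℓ`] = the `p`-part of BSD"; NOTE the sum is over ALL bad `ℓ`, the prime `p`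
  INCLUDED when `p² ∣ N` — that is what Miller's `BSD(E,p)` forces given (6), whatever normalisation a
  conjecture on `∂^{(∞)}` chooses; team row T-N10C types Kim's conjecture itself), the X4♯ INEQUALITY
  `ord_p #Ш ≤ ord_p #Ш_an + ord_p ∏ c_ℓ` (`sha_le_of_rankZero_witness`), and the STEP-0 anchor
  `kimShaLengthRankZeroAt_of_kim_of_kuriharaUnitAt`: at `p ≥ 5` the tree's PUBLISHED fact
  `Kim2022_rankZero_padicValRat_sha_of_kuriharaNumber_ne_zero_of_maninConstant` + ONE unit certificate
  (`X4.KuriharaUnitAt`) give `KimShaLengthRankZeroAt` with `d = 0`.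
* §3 — in the SIBLING file `Additive/X4SharpThreeKimShaLength.lean` (size split): the `∂`-EXACT N11
  hypothesis at `p = 3` in the binder shape of team n1011's `Additive/X4SharpThreeKimShape.lean`
  (`Additive.KimRankZeroShaLengthAt`, `KimThreeShaLength`, `X4SharpThreeKimShaLength`), its
  relations to the unit / inequality shapes, and what `BSD(E,3)` becomes under it.

STATUS OF THE STATEMENTS. At `p ≥ 5` (surj, Manin) `KimShaLengthAt` / the binder predicate are Kim's
THEOREM (AJM 148 Thm. 1.8 (6)) — but only its unit and inequality shapes are tree facts, so no
`_of_five_le` theorem is claimed for the `∂`-exact shape (T-N10K's level-`k` fact is the nearest).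
At `p = 3` the statement is ANNOUNCED: C.-H. Kim (app. R. Pollack), *The refined Tamagawa number
conjectures for GL₂*, arXiv:2505.09121 (2025, PREPRINT) Thm. 1.1/1.2 (`p ≥ 3`, large image, minimal
integral periods `Ω^±_{f,min}`; the `p = 3` Kolyvagin-system input is Sakamoto, JTNB 36 (2024) —
located by n1011-p09, OWNERS T-a4, who types it as a cited OPEN record; this file does not). The
difference `∂^{(0)} − ∂^{(∞)}` is insensitive to a common rescaling of the collection, which is why the
verbatim core is typed on `f`'s own numbers (`Ω⁺_f`-normalised) and the period enters only in §1's
BSD-currency reading. Levels: CYCLIC Kolyvagin levels (`IsCyclicKolyvaginLevel`), as in every Kim-type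
fact of the tree (Mazur–Rubin transversality; a Kolyvagin system restricted to a positive-density
admissible set of primes has the same elementary divisors). The EXOTIC rows (surj(3), no tower;
Elkies) and the non-surjective rows (O8) are outside every predicate below, as they are outside
every printed or announced route.

References: C.-H. Kim, Amer. J. Math. 148 (2026) 79–129 = arXiv:2203.12159v4, Thm. 1.9 (= journal
1.8) (1)(5)(6), Conj. 1.10 (= journal 1.9), §1.3.5, §1.4.3–1.4.4, §1.5.1, §2.5.1, Def. 2.13, Thm. 2.14
[Kim2022StructureSelmer]; C.-H. Kim, arXiv:2505.09121 (2025), Thm. 1.1, Thm. 1.2, §3.2.2 (PRE);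
R. Sakamoto, J. Théor. Nombres Bordeaux 36 (2024) 919–946; K. Rubin, *Euler systems and Kolyvagin
systems*, PCMS 18 (2011) §2.4 (H.4) "Either `Ā ≇ Ā*`, or `p ≥ 5`"; Miller, LMS J. Comput. Math. 14
(2011) Def. 1.1 [Miller2011LMS]; cell files CLASS-CLOSURE-PLAN.md §3.1, cells/n1011/OWNERS.md,
cells/n1011/KIM-AT-3-ANATOMY.md, class-closure/N11/TYPED-TARGETS-cc-typer-1.md.
-/

noncomputable section

open scoped Classical MatrixGroups ModularForm

open CongruenceSubgroup WeierstrassCurve Literature.NumberTheory.EllipticCurves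
  Literature.NumberTheory.EllipticCurves.ModularForms
  Literature.NumberTheory.EllipticCurves.Rank1Residual
  Literature.NumberTheory.EllipticCurves.Rank1Residual.Typed

namespace Summit.BirchSwinnertonDyer.Rank1Residual.X4

/-! ### §1 The typed core of Kim's Theorem 1.8 (6) at a pair `(E, p)` for a newform `f` -/

section Core

variable (W : WeierstrassCurve ℚ) [W.IsElliptic] [W.IsGloballyMinimal] (p : ℕ) {N : ℕ}
  (f : CuspForm (Gamma0 N) 2)

/-- **Kim's structure theorem, clause (6), VERBATIM CORE at `(E, p)`** (C.-H. Kim, Amer. J. Math.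
148 (2026), Thm. 1.8 = arXiv:2203.12159v4 Thm. 1.9 (6): "If `ord(δ̃) < ∞` … If we further assume
the finiteness of `Ш(E/ℚ)[p^∞]`, then … (6) `length_{ℤ_p}(Ш(E/ℚ)[p^∞]) = ∂^{(ord(δ̃))}(δ̃) − ∂^{(∞)}(δ̃)`",
with Thm. 2.14: "`∂^{(s)}` … finite for `s ≥ ord(κ)`"), as a predicate on the pair and the cusp form
`f` whose Kurihara numbers are read (`kuriharaVanishingOrder`, `kuriharaPartial`,
`kuriharaPartialInfty`; cyclic levels; `Ω⁺_f`-normalised — the difference `∂^{(r)} − ∂^{(∞)}` does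
not see the normalisation): for every `r : ℕ` with `ord(δ̃) = r`, `∂^{(∞)}(δ̃)` is a natural number
`d` and `∂^{(r)}(δ̃) = ord_p #Ш(E/ℚ)(p) + d`. A THEOREM for `p ≥ 5`, `ρ̄` onto, Manin constant prime
to `p` (Kim 2026); ANNOUNCED for `p ≥ 3` under large image (Kim, arXiv:2505.09121 Thm. 1.1, PRE);
typed here as an open predicate. Nothing asserted.
[cite: Kim2022StructureSelmer, Thm. 1.9 (6) (PDF p. 8), Thm. 2.14 (PDF p. 14), §1.4.4 and §1.5.1 (PDF p. 7)] -/
@[conjecture] def KimShaLengthAt : Prop :=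
  ∀ r : ℕ, kuriharaVanishingOrder W p f = r →
    ∃ d : ℕ, kuriharaPartialInfty W p f = d ∧
      kuriharaPartial W p f r =
        ((padicValNat p (Nat.card (AddCommGroup.primaryComponent W.sha p)) + d : ℕ) : ℕ∞)

/-- **Clause (6) in analytic rank `0`, READ IN BSD CURRENCY at `(E, p)`** with Kim's definition
"`∂^{(0)}(δ̃)` = the `p`-adic valuation of `δ̃_1`", `δ̃_1 = [0]⁺ = L(E,1)/Ω⁺_E` (§1.5.1, §1.4.3;
`Ω⁺_E` = Néron period of the minimal model = the tree's `W.realPeriodRat`), so that `ord(δ̃) = 0`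
and (6) says `ord_p #Ш(E/ℚ)(p) = ord_p(L(E,1)/Ω⁺_E) − ∂^{(∞)}(δ̃)`: THERE ARE `q ∈ ℚ` and `d ∈ ℕ` with
`L(E,1)/Ω(W) = q`, `∂^{(∞)}(δ̃) = d` and `ord_p q = ord_p #Ш(E/ℚ)(p) + d`. The shape of the tree's
unit-Kurihara-number facts (`Kim2022_rankZero_padicValRat_sha_of_kuriharaNumber_ne_zero[_of_maninConstant]`,
there `d = 0`) with the unit removed; obtained from `KimShaLengthAt` under the period transfer
(`kimShaLengthRankZeroAt_of_kimShaLengthAt`). Nothing asserted.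
[cite: Kim2022StructureSelmer, Thm. 1.9 (6) (PDF p. 8), §1.4.3 and §1.5.1 (PDF p. 7)] -/
@[conjecture] def KimShaLengthRankZeroAt : Prop :=
  ∃ (q : ℚ) (d : ℕ), W.entireLFunction 1 / (W.realPeriodRat : ℂ) = (q : ℂ) ∧
    kuriharaPartialInfty W p f = d ∧
    padicValRat p q = (padicValNat p (Nat.card (AddCommGroup.primaryComponent W.sha p)) : ℤ) + d

end Core

/-! ### §2 Fact-free bookkeeping: what the rank-`0` witness `(q, d)` buys; the bridge; STEP-0 -/

section Bookkeeping

variable (W : WeierstrassCurve ℚ) [W.IsElliptic] [W.IsGloballyMinimal] (p : ℕ) [Fact p.Prime]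

omit [W.IsGloballyMinimal] in
/-- **`BSD(E,p) ⟺ ∂^{(∞)}(δ̃) = ord_p ∏_ℓ c_ℓ(E)` under clause (6) in rank `0`.** In analytic rank
`0` (`L(E,1) ≠ 0`), with `rank E(ℚ) = r_an`, `Ш(E/ℚ)` finite, `E[p]` irreducible (so
`p ∤ #E(ℚ)_tors`) and a witness `L(E,1)/Ω(W) = q`, `ord_p q = ord_p #Ш(E/ℚ)(p) + d`:
`#Ш_an = q·#E(ℚ)_tors²/∏ c_ℓ`, hence Miller's `BSD(E,p)` (`ord_p #Ш_an = ord_p #Ш(p)`) holds iff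
`d = ord_p ∏_ℓ c_ℓ` — ALL bad primes `ℓ`, the prime `p` included when `p² ∣ N`. The kernel form of
"(6) + Kim's Conjecture 1.9 (`∂^{(∞)}(δ̃) = ∑_{ℓ∣N} ord_p c_ℓ`) = the `p`-part of BSD in rank `0`".
Fact-free. [cite: Kim2022StructureSelmer, Thm. 1.9 (6) and Conj. 1.10 (PDF p. 8)]
[cite: Miller2011LMS, Def. 1.1 (arXiv:1010.2431 p. 3)] -/
theorem bsdp_iff_eq_tamagawa_of_rankZero_witness
    (hmw : W.mordellWeilRank = W.analyticRank) (hfin : Finite W.sha)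
    (hL : W.entireLFunction 1 ≠ 0) (hirr : W.HasIrreducibleModPGaloisRep p) {q : ℚ} {d : ℕ}
    (hq : W.entireLFunction 1 / (W.realPeriodRat : ℂ) = (q : ℂ))
    (hval : padicValRat p q =
      (padicValNat p (Nat.card (AddCommGroup.primaryComponent W.sha p)) : ℤ) + d) :
    BSDp W p ↔ d = padicValNat p W.tamagawaProduct := by
  have hr0 : W.analyticRank = 0 := analyticRank_eq_zero_of_entireLFunction_one_ne_zero hL
  have hmw0 : W.mordellWeilRank = 0 := by rw [hmw, hr0]
  have hΩpos : 0 < W.realPeriodRat := by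
    haveI : (W.baseChange ℝ).IsElliptic := by rw [baseChange]; infer_instance
    exact (W.baseChange ℝ).realPeriod_pos'
  have hΩ : (W.realPeriodRat : ℂ) ≠ 0 := by exact_mod_cast hΩpos.ne'
  rw [div_eq_iff hΩ] at hq
  have hq0 : q ≠ 0 := by
    rintro rfl
    apply hL
    rw [hq]; simp
  have ht0 : (W.torsionOrder : ℚ) ≠ 0 := by exact_mod_cast (W.torsionOrder_pos_holds).ne'
  have hc0 : (W.tamagawaProduct : ℚ) ≠ 0 := by exact_mod_cast (W.tamagawaProduct_pos').ne'
  -- `#Ш_an = q · #tors² / ∏ c` in analytic rank `0`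
  have hsha : shaAn W = ((q * (W.torsionOrder : ℚ) ^ 2 / (W.tamagawaProduct : ℚ) : ℚ) : ℂ) := by
    have hR : W.regulator = 1 := W.regulator_eq_one_of_rank_zero hmw0
    have hc0' : (W.tamagawaProduct : ℂ) ≠ 0 := by exact_mod_cast (W.tamagawaProduct_pos').ne'
    rw [shaAn_def, WeierstrassCurve.leadingLCoeff, hr0, iteratedDeriv_zero, Nat.factorial_zero,
      Nat.cast_one, div_one, hq, hR]
    push_cast
    field_simp
  -- its valuation: `ord_p q − ord_p ∏ c` (the torsion is prime to `p`)
  have htors0 : padicValNat p W.torsionOrder = 0 :=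
    padicValNat_torsionOrder_eq_zero_of_irreducible W p hirr
  have hvq : padicValRat p (q * (W.torsionOrder : ℚ) ^ 2 / (W.tamagawaProduct : ℚ)) =
      padicValRat p q - padicValNat p W.tamagawaProduct := by
    have h2 : padicValRat p ((W.torsionOrder : ℚ) ^ 2) = 2 * padicValRat p (W.torsionOrder : ℚ) := by
      rw [pow_two, padicValRat.mul ht0 ht0]; ring
    rw [padicValRat.div (mul_ne_zero hq0 (pow_ne_zero 2 ht0)) hc0,
      padicValRat.mul hq0 (pow_ne_zero 2 ht0), h2, padicValRat.of_nat, padicValRat.of_nat, htors0]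
    push_cast; ring
  constructor
  · rintro ⟨-, -, q', hq', hv'⟩
    have hqq : q' = q * (W.torsionOrder : ℚ) ^ 2 / (W.tamagawaProduct : ℚ) := by
      exact_mod_cast hq'.symm.trans hsha
    rw [hqq, hvq, hval] at hv'
    have h0 : (d : ℤ) = (padicValNat p W.tamagawaProduct : ℤ) := by linarith
    exact_mod_cast h0
  · intro hd
    haveI : Finite W.sha := hfin
    refine ⟨hmw, inferInstance, q * (W.torsionOrder : ℚ) ^ 2 / (W.tamagawaProduct : ℚ), hsha, ?_⟩
    rw [hvq, hval, hd]
    push_cast; ring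

omit [W.IsGloballyMinimal] in
/-- **The upper-bound (X4♯-shape) INEQUALITY from a rank-`0` witness**: with `(q, d)` as above and
`Ш(E/ℚ)` finite, `#Ш_an` is a rational `q'` with `ord_p #Ш(E/ℚ) ≤ ord_p q' + ord_p ∏_ℓ c_ℓ` (indeed
`ord_p q' + ord_p ∏ c_ℓ = ord_p q + 2 ord_p #tors = ord_p #Ш + d + 2 ord_p #tors`). This is the
conclusion of the cell's `Additive.X4SharpThree` at the pair. Fact-free.
[cite: Kim2022StructureSelmer, Thm. 1.9 (6) (PDF p. 8)] [cite: Miller2011LMS, Def. 1.1] -/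
theorem sha_le_of_rankZero_witness
    (hmw : W.mordellWeilRank = W.analyticRank) (hfin : Finite W.sha)
    (hL : W.entireLFunction 1 ≠ 0) {q : ℚ} {d : ℕ}
    (hq : W.entireLFunction 1 / (W.realPeriodRat : ℂ) = (q : ℂ))
    (hval : padicValRat p q =
      (padicValNat p (Nat.card (AddCommGroup.primaryComponent W.sha p)) : ℤ) + d) :
    ∃ q' : ℚ, shaAn W = (q' : ℂ) ∧
      (padicValNat p W.shaOrder : ℤ) ≤ padicValRat p q' + padicValNat p W.tamagawaProduct := by
  have hr0 : W.analyticRank = 0 := analyticRank_eq_zero_of_entireLFunction_one_ne_zero hL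
  have hmw0 : W.mordellWeilRank = 0 := by rw [hmw, hr0]
  have hΩpos : 0 < W.realPeriodRat := by
    haveI : (W.baseChange ℝ).IsElliptic := by rw [baseChange]; infer_instance
    exact (W.baseChange ℝ).realPeriod_pos'
  have hΩ : (W.realPeriodRat : ℂ) ≠ 0 := by exact_mod_cast hΩpos.ne'
  rw [div_eq_iff hΩ] at hq
  have hq0 : q ≠ 0 := by
    rintro rfl
    apply hL
    rw [hq]; simp
  have ht0 : (W.torsionOrder : ℚ) ≠ 0 := by exact_mod_cast (W.torsionOrder_pos_holds).ne'
  have hc0 : (W.tamagawaProduct : ℚ) ≠ 0 := by exact_mod_cast (W.tamagawaProduct_pos').ne'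
  have hsha : shaAn W = ((q * (W.torsionOrder : ℚ) ^ 2 / (W.tamagawaProduct : ℚ) : ℚ) : ℂ) := by
    have hR : W.regulator = 1 := W.regulator_eq_one_of_rank_zero hmw0
    have hc0' : (W.tamagawaProduct : ℂ) ≠ 0 := by exact_mod_cast (W.tamagawaProduct_pos').ne'
    rw [shaAn_def, WeierstrassCurve.leadingLCoeff, hr0, iteratedDeriv_zero, Nat.factorial_zero,
      Nat.cast_one, div_one, hq, hR]
    push_cast
    field_simp
  have hvq : padicValRat p (q * (W.torsionOrder : ℚ) ^ 2 / (W.tamagawaProduct : ℚ)) =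
      padicValRat p q + 2 * padicValNat p W.torsionOrder - padicValNat p W.tamagawaProduct := by
    have h2 : padicValRat p ((W.torsionOrder : ℚ) ^ 2) = 2 * padicValRat p (W.torsionOrder : ℚ) := by
      rw [pow_two, padicValRat.mul ht0 ht0]; ring
    rw [padicValRat.div (mul_ne_zero hq0 (pow_ne_zero 2 ht0)) hc0,
      padicValRat.mul hq0 (pow_ne_zero 2 ht0), h2, padicValRat.of_nat, padicValRat.of_nat]
  haveI : Finite W.sha := hfin
  have hshaOrd : padicValNat p (Nat.card (AddCommGroup.primaryComponent W.sha p)) =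
      padicValNat p W.shaOrder := by
    unfold WeierstrassCurve.shaOrder
    exact padicValNat_card_addPrimaryComponent p
  refine ⟨q * (W.torsionOrder : ℚ) ^ 2 / (W.tamagawaProduct : ℚ), hsha, ?_⟩
  rw [hvq, hval, hshaOrd]
  have : (0 : ℤ) ≤ (padicValNat p W.torsionOrder : ℤ) := by positivity
  have : (0 : ℤ) ≤ (d : ℤ) := by positivity
  linarith

omit [W.IsElliptic] [W.IsGloballyMinimal] in
/-- A rational `p`-adic unit has valuation `0`: `‖(u : ℚ_p)‖ = 1 ⇒ ord_p u = 0` (the period-transfer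
binder `Ω(W) = u · Ω⁺_f`, `|u|_p = 1`, read on valuations). [folklore] -/
private theorem padicValRat_eq_zero_of_norm_eq_one {u : ℚ} (hu : ‖(u : ℚ_[p])‖ = 1) :
    padicValRat p u = 0 := by
  have hu0 : (u : ℚ_[p]) ≠ 0 := by
    intro h
    rw [h, norm_zero] at hu
    exact zero_ne_one hu
  rw [Padic.norm_eq_zpow_neg_valuation hu0, Padic.valuation_ratCast] at hu
  have hp1 : (1 : ℝ) < (p : ℝ) := by exact_mod_cast (Fact.out : p.Prime).one_lt
  have h := (zpow_eq_one_iff_right₀ (zero_le_one.trans hp1.le) hp1.ne').mp hu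
  linarith

/-- **The bridge: clause (6) verbatim ⇒ its BSD-currency reading in analytic rank `0`.** For the
datum `D` (newform `D.f` of `W`), `p` odd, `E[p]` irreducible (so `[0]⁺_{D.f}` is `p`-integral,
`IsNewformOf.norm_ratPlusSymbol_le_one`), the period transfer `Ω(W) = u·Ω⁺_{D.f}`, `|u|_p = 1`, and
`L(E,1) ≠ 0`: `L(E,1) = [0]⁺_{D.f}·Ω⁺_{D.f}` (`IsNewformOf.entireLFunction_one_eq`), so
`L(E,1)/Ω(W) = [0]⁺/u` has `ord_p = ord_p [0]⁺ = ∂^{(0)}(δ̃)` (`kuriharaPartial_zero`,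
`kuriharaDivIndex_one_eq`), `ord(δ̃) = 0`, and `KimShaLengthAt` at `r = 0` is `KimShaLengthRankZeroAt`.
[cite: Kim2022StructureSelmer, §1.4.3 and §1.5.1 (PDF p. 7)] [cite: MazurTateTeitelbaum1986Invent, §I.8 (8.6)] -/
theorem kimShaLengthRankZeroAt_of_kimShaLengthAt (hp2 : p ≠ 2)
    (hirr : W.HasIrreducibleModPGaloisRep p) (hL : W.entireLFunction 1 ≠ 0)
    {N : ℕ} [NeZero N] (D : ModularParametrizationData W N)
    (hper : ∃ u : ℚ, ‖(u : ℚ_[p])‖ = 1 ∧ W.realPeriodRat = u * plusPeriod D.f)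
    (h6 : KimShaLengthAt W p D.f) : KimShaLengthRankZeroAt W p D.f := by
  -- `p`-integrality and non-vanishing of `[0]⁺_f`
  have hint : ¬ p ∣ (ratPlusSymbol D.f 0).den :=
    not_dvd_den_of_norm_ratCast_le_one
      (D.isNewformOf.norm_ratPlusSymbol_le_one (x := 0) hp2 hirr (by simp))
  have hLeq := D.isNewformOf.entireLFunction_one_eq
  have hne : ratPlusSymbol D.f 0 ≠ 0 := by
    intro h0
    apply hL
    rw [hLeq, h0]
    simp
  -- `ord(δ̃) = 0` and clause (6) at `r = 0`
  obtain ⟨d, hd, h0⟩ := h6 0 (kuriharaVanishingOrder_eq_zero_of_ratPlusSymbol_ne_zero W p D.f hint hne)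
  rw [kuriharaPartial_zero, kuriharaDivIndex_one_eq W p D.f hint hne] at h0
  have hnat : (padicValRat p (ratPlusSymbol D.f 0)).toNat =
      padicValNat p (Nat.card (AddCommGroup.primaryComponent W.sha p)) + d := by
    exact_mod_cast h0
  have hv0 : 0 ≤ padicValRat p (ratPlusSymbol D.f 0) := by
    unfold padicValRat
    rw [padicValNat.eq_zero_of_not_dvd hint]
    simp
  have hval : padicValRat p (ratPlusSymbol D.f 0) =
      (padicValNat p (Nat.card (AddCommGroup.primaryComponent W.sha p)) : ℤ) + d := by
    have := Int.toNat_of_nonneg hv0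
    rw [← this, hnat]
    push_cast
    ring
  -- the period transfer: `L(E,1)/Ω(W) = [0]⁺/u`, `ord_p u = 0`
  obtain ⟨u, hu, hΩ⟩ := hper
  have hu0 : u ≠ 0 := by
    rintro rfl
    rw [Rat.cast_zero, norm_zero] at hu
    exact zero_ne_one hu
  have hΩf : 0 < plusPeriod D.f :=
    IsNewform0.plusPeriod_pos_holds D.isNewformOf.1 D.isNewformOf.coeffField_eq_bot
  refine ⟨ratPlusSymbol D.f 0 / u, d, ?_, hd, ?_⟩
  · rw [hLeq, hΩ]
    have hu' : (u : ℂ) ≠ 0 := by exact_mod_cast hu0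
    have hΩf' : ((plusPeriod D.f : ℝ) : ℂ) ≠ 0 := by exact_mod_cast hΩf.ne'
    push_cast
    field_simp
  · rw [padicValRat.div hne hu0, padicValRat_eq_zero_of_norm_eq_one p hu, sub_zero, hval]

/-- **STEP-0 anchor (`p ≥ 5`, where (6) is Kim's THEOREM): the tree's published unit fact gives the
typed predicate.** Kim 2026 Thm. 1.8 (6) in its any-reduction rank-`0` unit shape (named fact `hKim`
= `Kim2022_rankZero_padicValRat_sha_of_kuriharaNumber_ne_zero_of_maninConstant`), at `p ≥ 5`, `ρ̄`
onto, `L(E,1) ≠ 0`, `Ш` finite, a datum `D` with `p ∤ c_D`, the period transfer, and ONE unit Kurihara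
number at a cyclic level (`KuriharaUnitAt W p D.f`) yields `KimShaLengthRankZeroAt W p D.f` with
`d = ∂^{(∞)}(δ̃) = 0` (`kuriharaPartialInfty_eq_zero_of_ne_zero`). So the census's blind reproduction
of Kim (6) at `p ∈ {5, 7}` (S0-KUR) and the `p = 3` hypothesis of §3 are instances of ONE predicate.
[cite: Kim2022StructureSelmer, Thm. 1.9 (1) and (6) (PDF pp. 7–8), §1.5.1 (PDF p. 7)] -/
theorem kimShaLengthRankZeroAt_of_kim_of_kuriharaUnitAt
    (hKim : Kim2022_rankZero_padicValRat_sha_of_kuriharaNumber_ne_zero_of_maninConstant)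
    (hp : 5 ≤ p) (hsurj : W.HasSurjectiveModNGaloisRep p) (hL : W.entireLFunction 1 ≠ 0)
    (hfin : Finite W.sha) {N : ℕ} [NeZero N] (D : ModularParametrizationData W N)
    (hc : ¬ (p : ℤ) ∣ D.maninConstant)
    (hper : ∃ u : ℚ, ‖(u : ℚ_[p])‖ = 1 ∧ W.realPeriodRat = u * plusPeriod D.f)
    (hK : KuriharaUnitAt W p D.f) : KimShaLengthRankZeroAt W p D.f := by
  obtain ⟨n, hn0, hn, hcyc, ψ, hψ, hδ⟩ := hK
  haveI := hn0
  obtain ⟨q, hq, hval⟩ := hKim W p hp hsurj hL hfin D hc hper n hn hcyc ψ hψ hδ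
  have h0 : kuriharaPartialInfty W p D.f = 0 :=
    kuriharaPartialInfty_eq_zero_of_ne_zero W p D.f ⟨hn, hcyc⟩ ψ hψ hδ
  refine ⟨q, 0, hq, by rw [h0, Nat.cast_zero], ?_⟩
  rw [hval, Nat.cast_zero, add_zero]

end Bookkeeping

end Summit.BirchSwinnertonDyer.Rank1Residual.X4

end
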